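import Mathlib
import HarnessLib

/-!
# T72c — occupied cells from a second moment (solo-informed, rigidity line R4, abstract part)

Third file of the local pair-correlation rigidity line (sharpest statement §2k (xi), plan T72):
the elementary covering step of Lemma 2k.E, with no zeta input. A window `W = [A, A + J/b)` is
cut into `J` cells `C_j = [A + j/b, A + (j+1)/b)`; weighted points `γ_k ∈ W` (weights
`w_k ≥ 0`, total mass `N = ∑ w_k`) are given, together with a function `Z ≥ 0` on `W` which at
every `t ∈ W` dominates `bμ` times the mass within `1/b` of `t` (the zero side of a probe whose
transform is `≥ bμ` near its centre). Then on each cell `Z ≥ bμ · (mass of the cell)`, so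

  `∫_W Z² ≥ ∑_j (1/b)(bμ n_j)² = bμ² ∑_j n_j² ≥ bμ² N² / M`   (Cauchy–Schwarz),

`M` = the number of OCCUPIED cells: **`bμ² N² ≤ M · ∫_W Z²`**
(`mul_sq_mass_le_card_mul_integral_sq`). Read contrapositively: a SMALL second moment of `Z`
over the window and a LARGE mass `N` force MANY occupied cells — the points cannot cluster. In
T72 this is applied with `γ_k` = the ordinates of the zeros of `ζ` in a window (weights = the
multiplicities, `N` = the Riemann–von Mangoldt mass), `Z(t) = Re Q(f_{b,t})` for the modulated
probe `f_{b,t}`, whose second moment is controlled on the geometric side of the explicit formula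
by the mean value theorem T72a.

References: H. L. Montgomery, *The pair correlation of zeros of the zeta function*, Proc. Sympos.
Pure Math. 24 (1973) 181–193 (the second-moment method); the covering step is folklore.
-/

open Set MeasureTheory Finset
open scoped Real

namespace Summit.RiemannHypothesis.RiemannHypothesis.Theorems

/-- The cells `[A + i/b, A + (i+1)/b)` and `[A + j/b, A + (j+1)/b)` are disjoint for `i < j`
(`b > 0`). -/
theorem cell_disjoint {A b : ℝ} (hb : 0 < b) {i j : ℕ} (hij : i < j) :
    Disjoint (Ico (A + i / b) (A + (i + 1) / b)) (Ico (A + j / b) (A + (j + 1) / b)) := by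
  refine Set.disjoint_left.2 fun x hx hx' ↦ ?_
  have h1 : ((i : ℝ) + 1) / b ≤ j / b :=
    div_le_div_of_nonneg_right (by exact_mod_cast hij) hb.le
  exact (lt_irrefl x) (lt_of_lt_of_le hx.2 (by linarith [hx'.1]))

/-- Every point of the window `[A, A + J/b)` lies in the cell of index `⌊(x - A) b⌋ < J`. -/
theorem mem_cell_floor {A b x : ℝ} (hb : 0 < b) {J : ℕ} (hx : x ∈ Ico A (A + J / b)) :
    ⌊(x - A) * b⌋₊ < J ∧
      x ∈ Ico (A + (⌊(x - A) * b⌋₊ : ℕ) / b) (A + ((⌊(x - A) * b⌋₊ : ℕ) + 1) / b) := by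
  obtain ⟨h1, h2⟩ := hx
  have hx0 : 0 ≤ (x - A) * b := mul_nonneg (by linarith) hb.le
  have hxJ : (x - A) * b < J := (lt_div_iff₀ hb).1 (by linarith)
  refine ⟨(Nat.floor_lt hx0).2 hxJ, ?_, ?_⟩
  · have h := (div_le_iff₀ hb).2 (Nat.floor_le hx0)
    linarith
  · have h := (lt_div_iff₀ hb).2 (Nat.lt_floor_add_one ((x - A) * b))
    linarith

/-- **Occupied cells from a second moment.** Let `b > 0`, `μ ≥ 0`, let `γ_k` (`k ∈ S`) be
points of the window `W = [A, A + J/b)` with weights `w_k ≥ 0`, and let `Z : ℝ → ℝ` satisfy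
`Z(t) ≥ bμ · ∑_{|γ_k - t| ≤ 1/b} w_k` for `t ∈ W`, with `Z²` integrable on `W`. If every cell
`[A + j/b, A + (j+1)/b)`, `j < J`, containing some `γ_k` has its index in `Occ`, then
`b μ² (∑_k w_k)² ≤ #Occ · ∫_W Z²`. -/
theorem mul_sq_mass_le_card_mul_integral_sq {ι : Type*} (S : Finset ι) (γ w : ι → ℝ)
    (hw : ∀ k ∈ S, 0 ≤ w k) {b μ : ℝ} (hb : 0 < b) (hμ : 0 ≤ μ) (A : ℝ) (J : ℕ)
    (hγ : ∀ k ∈ S, γ k ∈ Ico A (A + J / b)) (Z : ℝ → ℝ)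
    (hZ : ∀ t ∈ Ico A (A + J / b),
      b * μ * (∑ k ∈ S, if |γ k - t| ≤ 1 / b then w k else 0) ≤ Z t)
    (hint : IntegrableOn (fun t ↦ Z t ^ 2) (Ico A (A + J / b)))
    (Occ : Finset ℕ)
    (hOcc : ∀ j < J, ∀ k ∈ S, γ k ∈ Ico (A + j / b) (A + (j + 1) / b) → j ∈ Occ) :
    b * μ ^ 2 * (∑ k ∈ S, w k) ^ 2 ≤ Occ.card * ∫ t in Ico A (A + J / b), Z t ^ 2 := by
  classical
  -- cells and cell masses
  obtain ⟨C, hC⟩ : ∃ C : ℕ → Set ℝ, C = fun j : ℕ ↦ Ico (A + (j : ℝ) / b) (A + ((j : ℝ) + 1) / b) :=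
    ⟨_, rfl⟩
  obtain ⟨n, hn⟩ : ∃ n : ℕ → ℝ, n = fun j ↦ ∑ k ∈ S, if γ k ∈ C j then w k else 0 :=
    ⟨_, rfl⟩
  have hterm0 : ∀ j, ∀ k ∈ S, 0 ≤ (if γ k ∈ C j then w k else 0) := fun j k hk ↦ by
    split_ifs
    · exact hw k hk
    · exact le_rfl
  have hn0 : ∀ j, 0 ≤ n j := fun j ↦ by rw [hn]; exact sum_nonneg (hterm0 j)
  have hCW : ∀ j < J, C j ⊆ Ico A (A + J / b) := by
    intro j hj t ht
    rw [hC] at ht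
    obtain ⟨h1, h2⟩ := ht
    have hj' : (j : ℝ) + 1 ≤ J := by exact_mod_cast hj
    have hjb : (0 : ℝ) ≤ j / b := by positivity
    have hJb : ((j : ℝ) + 1) / b ≤ J / b := div_le_div_of_nonneg_right hj' hb.le
    exact ⟨by linarith, by linarith⟩
  -- Step 1: on the cell `C j`, `Z ≥ b μ n j`
  have hcell : ∀ j < J, ∀ t ∈ C j, b * μ * n j ≤ Z t := by
    intro j hj t ht
    refine le_trans (mul_le_mul_of_nonneg_left ?_ (by positivity)) (hZ t (hCW j hj ht))
    rw [hn]
    refine sum_le_sum fun k hk ↦ ?_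
    by_cases hkC : γ k ∈ C j
    · have hdist : |γ k - t| ≤ 1 / b := by
        rw [hC] at hkC ht
        obtain ⟨a1, a2⟩ := hkC
        obtain ⟨t1, t2⟩ := ht
        have e : ((j : ℝ) + 1) / b = j / b + 1 / b := by rw [add_div]
        rw [abs_le]
        exact ⟨by linarith, by linarith⟩
      rw [if_pos hkC, if_pos hdist]
    · rw [if_neg hkC]
      split_ifs
      · exact hw k hk
      · exact le_rfl
  -- Step 2: the integral over one cell
  have hmeasC : ∀ j, MeasurableSet (C j) := fun j ↦ by rw [hC]; exact measurableSet_Ico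
  have hvolC : ∀ j : ℕ, volume.real (C j) = 1 / b := by
    intro j
    rw [hC]
    simp only [Real.volume_real_Ico]
    rw [show A + ((j : ℝ) + 1) / b - (A + j / b) = 1 / b by ring,
      max_eq_left (by positivity)]
  have hintC : ∀ j < J, IntegrableOn (fun t ↦ Z t ^ 2) (C j) :=
    fun j hj ↦ hint.mono_set (hCW j hj)
  have hcellInt : ∀ j < J, b * μ ^ 2 * n j ^ 2 ≤ ∫ t in C j, Z t ^ 2 := by
    intro j hj
    have hconst : ∫ _ in C j, (b * μ * n j) ^ 2 = 1 / b * (b * μ * n j) ^ 2 := by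
      rw [setIntegral_const, hvolC, smul_eq_mul]
    have hconstInt : IntegrableOn (fun _ : ℝ ↦ (b * μ * n j) ^ 2) (C j) := by
      rw [hC]
      exact continuous_const.integrableOn_Icc.mono_set Ico_subset_Icc_self
    calc b * μ ^ 2 * n j ^ 2 = 1 / b * (b * μ * n j) ^ 2 := by
          rw [div_mul_eq_mul_div, one_mul, eq_div_iff hb.ne']; ring
      _ = ∫ _ in C j, (b * μ * n j) ^ 2 := hconst.symm
      _ ≤ ∫ t in C j, Z t ^ 2 :=
          setIntegral_mono_on hconstInt (hintC j hj) (hmeasC j) fun t ht ↦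
            pow_le_pow_left₀ (mul_nonneg (by positivity) (hn0 j)) (hcell j hj t ht) 2
  -- Step 3: the cells are disjoint pieces of the window
  have hdisj : Set.Pairwise (↑(range J) : Set ℕ) (Function.onFun Disjoint C) := by
    intro i _ j _ hij
    simp only [Function.onFun]
    rw [hC]
    rcases lt_or_gt_of_ne hij with h | h
    · exact cell_disjoint hb h
    · exact (cell_disjoint hb h).symm
  have hU : (⋃ j ∈ range J, C j) ⊆ Ico A (A + J / b) :=
    Set.iUnion₂_subset fun j hj ↦ hCW j (mem_range.1 hj)
  have hsumInt : ∑ j ∈ range J, ∫ t in C j, Z t ^ 2 ≤ ∫ t in Ico A (A + J / b), Z t ^ 2 := by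
    rw [← integral_biUnion_finset (range J) (fun j _ ↦ hmeasC j) hdisj
      (fun j hj ↦ hintC j (mem_range.1 hj))]
    exact setIntegral_mono_set hint (ae_of_all _ fun t ↦ sq_nonneg (Z t)) hU.eventuallyLE
  -- Step 4: the total mass is at most the sum of the cell masses
  have hNle : ∑ k ∈ S, w k ≤ ∑ j ∈ range J, n j := by
    have hswap : ∑ j ∈ range J, n j =
        ∑ k ∈ S, ∑ j ∈ range J, (if γ k ∈ C j then w k else 0) := by
      rw [hn]; exact sum_comm
    rw [hswap]
    refine sum_le_sum fun k hk ↦ ?_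
    obtain ⟨hj₀J, hmem⟩ := mem_cell_floor hb (hγ k hk)
    have hmem' : γ k ∈ C ⌊(γ k - A) * b⌋₊ := by rw [hC]; exact hmem
    calc w k = (if γ k ∈ C ⌊(γ k - A) * b⌋₊ then w k else 0) := by rw [if_pos hmem']
      _ ≤ ∑ j ∈ range J, (if γ k ∈ C j then w k else 0) :=
          single_le_sum (f := fun j ↦ if γ k ∈ C j then w k else 0)
            (fun j _ ↦ hterm0 j k hk) (mem_range.2 hj₀J)
  -- Step 5: empty cells carry no mass; Cauchy–Schwarz over the occupied ones
  obtain ⟨F, hF⟩ : ∃ F : Finset ℕ, F = (range J).filter (· ∈ Occ) := ⟨_, rfl⟩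
  have hFsub : F ⊆ range J := by rw [hF]; exact filter_subset _ _
  have hFcard : (F.card : ℝ) ≤ Occ.card := by
    rw [hF]
    exact_mod_cast Finset.card_le_card fun j hj ↦ (mem_filter.1 hj).2
  have hzero : ∀ j ∈ range J, j ∉ Occ → n j = 0 := by
    intro j hj hjO
    rw [hn]
    refine sum_eq_zero fun k hk ↦ ?_
    rw [if_neg]
    intro hkC
    rw [hC] at hkC
    exact hjO (hOcc j (mem_range.1 hj) k hk hkC)
  have hsumF : ∑ j ∈ range J, n j = ∑ j ∈ F, n j := by
    rw [hF, sum_filter]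
    refine sum_congr rfl fun j hj ↦ ?_
    split_ifs with h
    · rfl
    · exact hzero j hj h
  have hCS : (∑ j ∈ F, n j) ^ 2 ≤ F.card * ∑ j ∈ F, n j ^ 2 := by
    have hcs := sum_mul_sq_le_sq_mul_sq F n (fun _ ↦ (1 : ℝ))
    simp only [mul_one, one_pow, sum_const, nsmul_eq_mul] at hcs
    linarith
  have hFJ : ∑ j ∈ F, n j ^ 2 ≤ ∑ j ∈ range J, n j ^ 2 :=
    sum_le_sum_of_subset_of_nonneg hFsub fun j _ _ ↦ sq_nonneg (n j)
  -- assembly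
  have hN0 : 0 ≤ ∑ k ∈ S, w k := sum_nonneg hw
  have hI0 : 0 ≤ ∫ t in Ico A (A + J / b), Z t ^ 2 := setIntegral_nonneg measurableSet_Ico
    fun t _ ↦ sq_nonneg (Z t)
  have hS0 : 0 ≤ ∑ j ∈ range J, n j ^ 2 := sum_nonneg fun j _ ↦ sq_nonneg (n j)
  calc b * μ ^ 2 * (∑ k ∈ S, w k) ^ 2 ≤ b * μ ^ 2 * (∑ j ∈ F, n j) ^ 2 := by
        rw [← hsumF]; gcongr
    _ ≤ b * μ ^ 2 * (F.card * ∑ j ∈ F, n j ^ 2) := by gcongr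
    _ ≤ b * μ ^ 2 * (Occ.card * ∑ j ∈ range J, n j ^ 2) := by gcongr
    _ = Occ.card * ∑ j ∈ range J, b * μ ^ 2 * n j ^ 2 := by
        simp only [Finset.mul_sum]
        exact sum_congr rfl fun j _ ↦ by ring
    _ ≤ Occ.card * ∑ j ∈ range J, ∫ t in C j, Z t ^ 2 := by
        gcongr with j hj
        exact hcellInt j (mem_range.1 hj)
    _ ≤ Occ.card * ∫ t in Ico A (A + J / b), Z t ^ 2 := by gcongr

end Summit.RiemannHypothesis.RiemannHypothesis.Theorems
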